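import Summits.Ventures.DiscreteObjects.UnitDistance.Sqrt3TripleReduction
import Summits.Ventures.DiscreteObjects.UnitDistance.PadicCriterion
import HarnessLib

/-!
# Triple gadgets transported, and Heule's field in the kernel: `χ(ℚ(√3, √5, √11)²) = 5` (cell `pub-namedobj`, target (U), seat udg g23)

Framing (verbatim for the cell): lottery ticket; floor = certified bounds/negative ranges.

Continuation of `Sqrt3TripleReduction.lean` (every 4-colouring of `K²`, `√3, √5 ∈ K`, has a monochromatic positively oriented `√3`-triple —
de Grey's Part 2 plus a four-diagonal chain inside `ℚ(√15)`).  Two consequences: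
* `not_colorable_four_plane_of_triple_gadget` — TRANSPORT: a finite configuration `S ⊂ K(i)` with a positively oriented `√3`-triple `(a; b, c)`
  that no proper 4-colouring of the unit-distance graph on `S` makes monochromatic is carried onto every such triple of `K²` by the `K`-rational
  direct isometry `w ↦ x + u(w − a)`, `u = (y − x)·conj(b − a)/3`; hence `K²` is not 4-colourable.  This is the form in which a de Grey-type
  triple gadget over an admissible field `K ⊂ ℚ₁₁` would settle `χ(K²) = χ(ℚ₁₁²) = 5` (THEORY-U23 of the cell).
* `chromaticNumber_plane_heuleField` — HEULE'S FIELD: `χ(ℚ(√3, √5, √11)²) = 5` as a hypothesis-free kernel theorem.  Lower bound: de Grey's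
  1345-vertex `M` (kernel theorem `M1345_no_mono_triple`, `PlaneM1345.lean`, coordinates `(a + b√33 + i(c√3 + d√11))/12 ∈ K(i)`) is such a
  gadget over `ℚ(√3, √11)`; upper bound: the 11-adic reduction (`colorable_five_plane_heuleField`, `PadicCriterion.lean`).  de Grey's own
  assembly (`L`, `N`, the 1581-vertex graph) needs `√7`; none is used here.  In print the value 5 for this field is known through Heule's explicit
  5-chromatic graphs (SAT certificates); `five_le_chromaticNumber_plane_of_sqrt3_sqrt5_sqrt11` gives `χ(K²) ≥ 5` for every real field
  `K ∋ √3, √5, √11`, and `chromaticNumber_plane_eq_five_of_elevenAdic` the exact value `5` for every multiquadratic `ℚ(√S)`, `3, 5, 11 ∈ S`,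
  in an `11`-adic pattern (example: `ℚ(√3, √5, √11, √23)`).
The theorem is de Grey's/Heule's; the `√7`-free field form and the kernel proof are the cell's.  Nothing here is cited as a fact.
-/

noncomputable section

namespace Summit.Ventures.DiscreteObjects.UnitDistance

open Complex SimpleGraph IntermediateField KTri Sqrt3Triple

/-! ## Transport of a finite triple gadget by the `K`-rational direct isometries -/

namespace Sqrt3Triple

variable {K : IntermediateField ℚ ℝ}

/-- `K(i)` is closed under complex conjugation. -/
theorem memK_conj {z : ℂ} (hz : z ∈ pointsK K) : (starRingEnd ℂ) z ∈ pointsK K :=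
  ⟨by rw [Complex.conj_re]; exact hz.1, by rw [Complex.conj_im]; exact neg_mem hz.2⟩

/-- Division by `3` stays in `K(i)`. -/
theorem memK_div_three {z : ℂ} (hz : z ∈ pointsK K) : z / 3 ∈ pointsK K :=
  ⟨by rw [Complex.div_ofNat_re]; exact div_mem hz.1 (by exact_mod_cast IntermediateField.natCast_mem K 3),
   by rw [Complex.div_ofNat_im]; exact div_mem hz.2 (by exact_mod_cast IntermediateField.natCast_mem K 3)⟩

/-- TRANSPORT OF A FINITE TRIPLE GADGET.  Let `S ⊂ K(i)` be finite with a positively oriented `√3`-triple `(a; b, c)` such that every proper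
4-colouring of the unit-distance graph on `S` leaves `{a, b, c}` non-monochromatic.  Then NO positively oriented `√3`-triple `(x; y, z)` of
`K`-points is monochromatic under a 4-colouring `C` of `K²`: the direct isometry `w ↦ x + u(w − a)`, `u = (y − x)·conj(b − a)/3 ∈ K(i)`,
`‖u‖ = 1`, carries `S` into `K²` and `(a; b, c)` onto `(x; y, z)`. -/
theorem no_monochromatic_otriple_of_gadget (C : (planeUnitDistanceGraph.induce (fieldPoints K)).Coloring (Fin 4))
    (S : Finset ℂ) (hS : ∀ s ∈ S, s ∈ pointsK K) {a b c : ℂ} (ha : a ∈ S) (hb : b ∈ S) (habc : IsOTriple a b c)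
    (hgadget : ∀ f : ℂ → ℕ, (∀ s ∈ S, f s < 4) → (∀ s ∈ S, ∀ t ∈ S, ‖s - t‖ = 1 → f s ≠ f t) → ¬ (f a = f b ∧ f b = f c))
    {x y z : ℂ} (hx : x ∈ pointsK K) (hy : y ∈ pointsK K) (hxyz : IsOTriple x y z) :
    ¬ (col C x = col C y ∧ col C y = col C z) := by
  rintro ⟨exy, eyz⟩
  obtain ⟨h1, h2⟩ := habc
  have hnsq : Complex.normSq (b - a) = 3 := by rw [Complex.normSq_eq_norm_sq]; exact h1
  have hba : (b - a) * (starRingEnd ℂ) (b - a) = 3 := by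
    rw [Complex.mul_conj, hnsq]; norm_num
  let u : ℂ := (y - x) * (starRingEnd ℂ) (b - a) / 3
  have hu_mul : u * (b - a) = y - x := by
    have : u * (b - a) = (y - x) * ((b - a) * (starRingEnd ℂ) (b - a)) / 3 := by simp only [u]; ring
    rw [this, hba]; ring
  have hu : ‖u‖ = 1 := by
    have hprod : ‖u‖ * ‖b - a‖ = ‖y - x‖ := by rw [← norm_mul, hu_mul]
    have hn : ‖b - a‖ = Real.sqrt 3 := by rw [← Real.sqrt_sq (norm_nonneg (b - a)), h1]
    have hn' : ‖y - x‖ = Real.sqrt 3 := by rw [← Real.sqrt_sq (norm_nonneg (y - x)), hxyz.1]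
    rw [hn, hn'] at hprod
    have hs : Real.sqrt 3 ≠ 0 := by positivity
    exact mul_right_cancel₀ hs (by rw [hprod, one_mul])
  have humem : u ∈ pointsK K :=
    memK_div_three (memK_mul (memK_sub hy hx) (memK_conj (memK_sub (hS b hb) (hS a ha))))
  let φ : ℂ → ℂ := simil x u a
  have hφmem : ∀ s ∈ S, φ s ∈ pointsK K := fun s hs => memK_add hx (memK_mul humem (memK_sub (hS s hs) (hS a ha)))
  have hφa : φ a = x := by simp [φ, simil]
  have hφb : φ b = y := by
    show x + u * (b - a) = y
    rw [hu_mul]; ring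
  have hφc : φ c = z := by
    show x + u * (c - a) = z
    rw [h2, show u * (omegaC * (b - a)) = omegaC * (u * (b - a)) by ring, hu_mul, ← hxyz.2]; ring
  let f : ℂ → ℕ := fun s => col C (φ s)
  have hf4 : ∀ s ∈ S, f s < 4 := fun s hs => col_lt C (hφmem s hs)
  have hf : ∀ s ∈ S, ∀ t ∈ S, ‖s - t‖ = 1 → f s ≠ f t := by
    intro s hs t ht hst
    exact col_ne C (hφmem s hs) (hφmem t ht) (by rw [norm_simil_sub hu, hst])
  refine hgadget f hf4 hf ⟨?_, ?_⟩
  · show col C (φ a) = col C (φ b)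
    rw [hφa, hφb, exy]
  · show col C (φ b) = col C (φ c)
    rw [hφb, hφc, eyz]

end Sqrt3Triple

/-- FINITE TRIPLE GADGET ⇒ FIVE COLOURS: if a finite configuration `S ⊂ K(i)` (`√3, √5 ∈ K`) contains a positively oriented `√3`-triple
`(a; b, c)` that no proper 4-colouring of the unit-distance graph on `S` makes monochromatic, then the unit-distance graph of `K²` is not
4-colourable.  For an admissible `K ⊂ ℚ₁₁` such an `S` would settle `χ(K²) = 5` and `χ(ℚ₁₁²) = 5`; de Grey's `M` is such an `S` over the
(inadmissible) Moser field `ℚ(√3, √11)`. -/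
theorem not_colorable_four_plane_of_triple_gadget (K : IntermediateField ℚ ℝ) (h3 : Real.sqrt 3 ∈ K) (h5 : Real.sqrt 5 ∈ K)
    (S : Finset ℂ) (hS : ∀ s ∈ S, s ∈ pointsK K) {a b c : ℂ} (ha : a ∈ S) (hb : b ∈ S) (habc : IsOTriple a b c)
    (hgadget : ∀ f : ℂ → ℕ, (∀ s ∈ S, f s < 4) → (∀ s ∈ S, ∀ t ∈ S, ‖s - t‖ = 1 → f s ≠ f t) → ¬ (f a = f b ∧ f b = f c)) :
    ¬ (planeUnitDistanceGraph.induce (fieldPoints K)).Colorable 4 := by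
  rintro ⟨C⟩
  exact false_of_no_monochromatic_otriple C h3 h5 fun x y z hx hy _ hxyz =>
    no_monochromatic_otriple_of_gadget C S hS ha hb habc hgadget hx hy hxyz

/-! ## Heule's field in the kernel: `χ(ℚ(√3, √5, √11)²) = 5` via de Grey's `M` (Part 1) and the `ℚ(√15)`-chain assembly -/

namespace Sqrt3Triple

variable {K : IntermediateField ℚ ℝ}

/-- `√33 = √3·√11 ∈ K`. -/
theorem sqrt33_mem (h3 : Real.sqrt 3 ∈ K) (h11 : Real.sqrt 11 ∈ K) : Real.sqrt 33 ∈ K := by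
  rw [← sqrt3_mul_sqrt11]; exact mul_mem h3 h11

/-- The vertices `(a + b√33 + i(c√3 + d√11))/12` of de Grey's `M` are `K`-points when `√3, √11 ∈ K`. -/
theorem memK_pt33 (h3 : Real.sqrt 3 ∈ K) (h11 : Real.sqrt 11 ∈ K) (p : ℤ × ℤ × ℤ × ℤ) : pt33 p ∈ pointsK K := by
  refine ⟨?_, ?_⟩
  · show ((p.1 : ℝ) + p.2.1 * Real.sqrt 33) / 12 ∈ K
    exact div_mem (add_mem (intCast_mem K _) (mul_mem (intCast_mem K _) (sqrt33_mem h3 h11)))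
      (by exact_mod_cast IntermediateField.natCast_mem K 12)
  · show ((p.2.2.1 : ℝ) * Real.sqrt 3 + p.2.2.2 * Real.sqrt 11) / 12 ∈ K
    exact div_mem (add_mem (mul_mem (intCast_mem K _) h3) (mul_mem (intCast_mem K _) h11))
      (by exact_mod_cast IntermediateField.natCast_mem K 12)

/-- PART 1 INSIDE `K²` (`√3, √11 ∈ K`): de Grey's 1345-vertex `M` (kernel theorem `M1345_no_mono_triple`), moved by the `K`-rational direct
isometry `w ↦ x + u(w − P₁)`, `u = (y − x)·conj(P₂ − P₁)/3`, forbids a monochromatic positively oriented `√3`-triple of `K`-points. -/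
theorem no_monochromatic_otriple_of_M1345 (C : (planeUnitDistanceGraph.induce (fieldPoints K)).Coloring (Fin 4))
    (h3 : Real.sqrt 3 ∈ K) (h11 : Real.sqrt 11 ∈ K) {x y z : ℂ} (hx : x ∈ pointsK K) (hy : y ∈ pointsK K) (hxyz : IsOTriple x y z) :
    ¬ (col C x = col C y ∧ col C y = col C z) := by
  rintro ⟨hxy, hyz⟩
  set P₁ := pt33 (M1345co 37) with hP₁
  set P₂ := pt33 (M1345co 40) with hP₂
  set P₃ := pt33 (M1345co 42) with hP₃
  obtain ⟨hM1, hM2⟩ := M1345_central_otriple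
  have hP1m : P₁ ∈ pointsK K := memK_pt33 h3 h11 _
  have hP2m : P₂ ∈ pointsK K := memK_pt33 h3 h11 _
  have hnsq : Complex.normSq (P₂ - P₁) = 3 := by rw [Complex.normSq_eq_norm_sq]; exact hM1
  have hba : (P₂ - P₁) * (starRingEnd ℂ) (P₂ - P₁) = 3 := by
    rw [Complex.mul_conj, hnsq]; norm_num
  let u : ℂ := (y - x) * (starRingEnd ℂ) (P₂ - P₁) / 3
  have hu_mul : u * (P₂ - P₁) = y - x := by
    have : u * (P₂ - P₁) = (y - x) * ((P₂ - P₁) * (starRingEnd ℂ) (P₂ - P₁)) / 3 := by simp only [u]; ring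
    rw [this, hba]; ring
  have hu : ‖u‖ = 1 := by
    have hprod : ‖u‖ * ‖P₂ - P₁‖ = ‖y - x‖ := by rw [← norm_mul, hu_mul]
    have hn : ‖P₂ - P₁‖ = Real.sqrt 3 := by rw [← Real.sqrt_sq (norm_nonneg (P₂ - P₁)), hM1]
    have hn' : ‖y - x‖ = Real.sqrt 3 := by rw [← Real.sqrt_sq (norm_nonneg (y - x)), hxyz.1]
    rw [hn, hn'] at hprod
    have hs : Real.sqrt 3 ≠ 0 := by positivity
    exact mul_right_cancel₀ hs (by rw [hprod, one_mul])
  have humem : u ∈ pointsK K := memK_div_three (memK_mul (memK_sub hy hx) (memK_conj (memK_sub hP2m hP1m)))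
  let φ : ℂ → ℂ := simil x u P₁
  have hφmem : ∀ w, w ∈ pointsK K → φ w ∈ pointsK K := fun w hw => memK_add hx (memK_mul humem (memK_sub hw hP1m))
  have hφ1 : φ P₁ = x := by simp [φ, simil]
  have hφ2 : φ P₂ = y := by
    show x + u * (P₂ - P₁) = y
    rw [hu_mul]; ring
  have hφ3 : φ P₃ = z := by
    show x + u * (P₃ - P₁) = z
    rw [hM2, show u * (omegaC * (P₂ - P₁)) = omegaC * (u * (P₂ - P₁)) by ring, hu_mul, ← hxyz.2]; ring
  let col' : ℕ → ℕ := fun v => col C (φ (pt33 (M1345co v)))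
  have hP : KBits11S.Proper M1345nb 1345 col' := by
    intro v hv
    have hvmem : φ (pt33 (M1345co v)) ∈ pointsK K := hφmem _ (memK_pt33 h3 h11 (M1345co v))
    refine ⟨col_lt C hvmem, ?_⟩
    intro w _ hbit heq
    have hd : ‖pt33 (M1345co v) - pt33 (M1345co w)‖ = 1 := norm_sub_pt33 (M1345_unit_of_testBit v w hv hbit)
    have hwmem : φ (pt33 (M1345co w)) ∈ pointsK K := hφmem _ (memK_pt33 h3 h11 (M1345co w))
    have h1 : ‖φ (pt33 (M1345co v)) - φ (pt33 (M1345co w))‖ = 1 := by rw [norm_simil_sub hu, hd]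
    exact col_ne C hvmem hwmem h1 heq.symm
  refine M1345_no_mono_triple hP ⟨?_, ?_⟩
  · show col C (φ P₁) = col C (φ P₂)
    rw [hφ1, hφ2, hxy]
  · show col C (φ P₂) = col C (φ P₃)
    rw [hφ2, hφ3, hyz]

end Sqrt3Triple

/-- `χ(K²) ≥ 5` FOR EVERY REAL FIELD `K ∋ √3, √5, √11` — de Grey's theorem in field form, hypothesis-free in the kernel: Part 1 = `M`
(needs `√3, √11`), Part 2 = `K` and the four-diagonal chain (need `√3, √5`); no `√7` (de Grey's `L`) is used. -/
theorem not_colorable_four_plane_of_sqrt3_sqrt5_sqrt11 (K : IntermediateField ℚ ℝ) (h3 : Real.sqrt 3 ∈ K)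
    (h5 : Real.sqrt 5 ∈ K) (h11 : Real.sqrt 11 ∈ K) : ¬ (planeUnitDistanceGraph.induce (fieldPoints K)).Colorable 4 := by
  rintro ⟨C⟩
  exact false_of_no_monochromatic_otriple C h3 h5 fun x y z hx hy _ hxyz =>
    no_monochromatic_otriple_of_M1345 C h3 h11 hx hy hxyz

/-- HEULE'S FIELD IN THE KERNEL: `χ(ℚ(√3, √5, √11)²) = 5`.  Upper bound: the 11-adic reduction (`colorable_five_plane_heuleField`, udg g11);
lower bound: this file.  In print the value is known through Heule's explicit 5-chromatic graphs with coordinates in this field (SAT certificates);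
here it is a hypothesis-free kernel theorem with standard axioms. -/
theorem chromaticNumber_plane_heuleField :
    (planeUnitDistanceGraph.induce (fieldPoints (multiSqrtField {3, 5, 11}))).chromaticNumber = 5 := by
  refine le_antisymm colorable_five_plane_heuleField.chromaticNumber_le ?_
  have h3 : Real.sqrt 3 ∈ multiSqrtField {3, 5, 11} := by
    simpa using sqrt_mem_multiSqrtField (S := {3, 5, 11}) (d := 3) (by decide)
  have h5 : Real.sqrt 5 ∈ multiSqrtField {3, 5, 11} := by
    simpa using sqrt_mem_multiSqrtField (S := {3, 5, 11}) (d := 5) (by decide)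
  have h11 : Real.sqrt 11 ∈ multiSqrtField {3, 5, 11} := by
    simpa using sqrt_mem_multiSqrtField (S := {3, 5, 11}) (d := 11) (by decide)
  by_contra hlt
  have hlt' : (planeUnitDistanceGraph.induce (fieldPoints (multiSqrtField {3, 5, 11}))).chromaticNumber < (4 : ℕ∞) + 1 :=
    lt_of_not_ge hlt
  have hle : (planeUnitDistanceGraph.induce (fieldPoints (multiSqrtField {3, 5, 11}))).chromaticNumber ≤ (4 : ℕ) :=
    Order.le_of_lt_add_one hlt'
  exact not_colorable_four_plane_of_sqrt3_sqrt5_sqrt11 _ h3 h5 h11 (chromaticNumber_le_iff_colorable.mp hle)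

/-- Every real field containing `√3, √5, √11` — e.g. the fields of Heule's and Parts' record graphs and de Grey's `ℚ(√3,√5,√7,√11)` — has
`χ(K²) ≥ 5`; together with the 11-adic bound, `χ(K²) = 5` whenever all further radicands are squares mod `11`. -/
theorem five_le_chromaticNumber_plane_of_sqrt3_sqrt5_sqrt11 (K : IntermediateField ℚ ℝ) (h3 : Real.sqrt 3 ∈ K)
    (h5 : Real.sqrt 5 ∈ K) (h11 : Real.sqrt 11 ∈ K) : 5 ≤ (planeUnitDistanceGraph.induce (fieldPoints K)).chromaticNumber := by
  by_contra hlt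
  have hlt' : (planeUnitDistanceGraph.induce (fieldPoints K)).chromaticNumber < (4 : ℕ∞) + 1 := lt_of_not_ge hlt
  have hle : (planeUnitDistanceGraph.induce (fieldPoints K)).chromaticNumber ≤ (4 : ℕ) := Order.le_of_lt_add_one hlt'
  exact not_colorable_four_plane_of_sqrt3_sqrt5_sqrt11 K h3 h5 h11 (chromaticNumber_le_iff_colorable.mp hle)

/-- EXACT VALUE FOR A FAMILY: every real multiquadratic field `ℚ(√d : d ∈ S)` with `3, 5, 11 ∈ S` lying in an `11`-adic pattern (e.g. all
`d ∈ S` quadratic residues mod `11`, such as `{3, 5, 11}`, `{3, 5, 11, 23}`, `{3, 5, 11, 47}`) has `χ = 5` exactly: `≥ 5` by de Grey's `M` and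
the `ℚ(√15)`-chain, `≤ 5` by the 11-adic reduction. -/
theorem chromaticNumber_plane_eq_five_of_elevenAdic (S : Finset ℕ) (hS : PadicPattern 11 S) (h3 : 3 ∈ S) (h5 : 5 ∈ S)
    (h11 : 11 ∈ S) : (planeUnitDistanceGraph.induce (fieldPoints (multiSqrtField S))).chromaticNumber = 5 := by
  refine le_antisymm (colorable_five_plane_of_elevenAdic S hS).chromaticNumber_le ?_
  exact five_le_chromaticNumber_plane_of_sqrt3_sqrt5_sqrt11 _
    (by simpa using sqrt_mem_multiSqrtField (S := S) (d := 3) h3)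
    (by simpa using sqrt_mem_multiSqrtField (S := S) (d := 5) h5)
    (by simpa using sqrt_mem_multiSqrtField (S := S) (d := 11) h11)

/-- Example beyond Heule's field: `χ(ℚ(√3, √5, √11, √23)²) = 5` (`23 ≡ 1` is a residue mod `11`). -/
theorem chromaticNumber_plane_sqrt3_sqrt5_sqrt11_sqrt23 :
    (planeUnitDistanceGraph.induce (fieldPoints (multiSqrtField {3, 5, 11, 23}))).chromaticNumber = 5 :=
  chromaticNumber_plane_eq_five_of_elevenAdic _ (by decide) (by decide) (by decide) (by decide)

end Summit.Ventures.DiscreteObjects.UnitDistance
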